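import Summits.BirchSwinnertonDyer.BirchSwinnertonDyer.Theorems.GenusKolyvaginAtTwoMinimalTwinBSDTwoIdentityDoor
import Summits.BirchSwinnertonDyer.BirchSwinnertonDyer.Theorems.GenusKolyvaginAtTwoMinimalTwinBSDTwoSwappedPairExactDescent
import Summits.BirchSwinnertonDyer.BirchSwinnertonDyer.Theorems.GenusKolyvaginAtTwoMinimalTwinBSDTwoAllDepthCells
import Summits.BirchSwinnertonDyer.BirchSwinnertonDyer.Theorems.GenusKolyvaginAtTwoMinimalTwinBSDTwoEggSplit
import HarnessLib

/-!
# Route `GenusKolyvaginAtTwo`, crux U₂ `MinimalTwinBSDTwo` (stmt-BirchSwinnertonDyer-22985), LINE 23 «twin_swap»: THE IDENTITY-PRIME DOOR, part 3 —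
# the IDENTITY-LOCUS CELL ENGINE: BSD₂(W) on {`Δ > 0`, `W(ℚ) ⊂ W⁰(ℝ)`, `ρ̄_{W,2}` onto} ⟸ wall + rank-zero `2`-converse + identity-door SUPPLY +
# exactness-shaped exponent + print (the cell that v1.8/v1.9 of the skeleton DECLARED residual)

Seat `bsd-line-gk2-p2` g26 (PROVER seat 2/3, cell `bsd-f1-sign2`, LINE 23 holder), `--supports stmt-BirchSwinnertonDyer-22985` (helper; closes nothing).
THEOREMS ONLY (no definition, no named fact, no `sorry`); standard axioms.  **BSD is NOT proved by this file; U₂ is NOT proved; nothing is closed.**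
CONDITIONAL on the displayed hypotheses (PRINT ×5, the wall S1, the rank-zero `2`-converse CONV₀, the identity-door supply IDSUPPLY — a Čebotarev statement —
and the exactness-shaped exponent KEX_id), in the format of this lineage's `AllDepth.bsdp_negDisc_…` (p776404) and gk2-p3's `EggAllImages.bsdp_posDisc_egg_…_allImages`
(p777498), so that the skeleton v2.0 of LINE 23 composes the three sign/locus cells by name.

* `bsdp_posDisc_idLocus_of_wall_of_converse_of_idSupply_of_kex_of_facts` — see its docstring.  Inside: `natCard_selmerGroup_twin_eq_one_of_identityDoor`
  (part 2, UNCONDITIONAL) makes the supplied twin `2`-Selmer-trivial; CONV₀ gives `L(W^{(d_K)},1) ≠ 0`; S1 gives `BSD₂(Wd)`; `swappedPairDescentAtTwo_shaDepth_of_facts`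
  (p778694) descends with the exponent supplied by KEX_id.

References: [MazurRubin2010] Lemmas 2.9–2.11, Prop. 3.3; [Kramer1981] Thm. 1; [GrossZagier1986] V.§2 (2.2); [Milne1972ArithmeticAV] §1 Thm. 1; [Miller2011LMS] Def. 1.1.
-/

set_option autoImplicit false
set_option linter.dupNamespace false -- `Summit.<P>.<Sub>` repeats `BirchSwinnertonDyer` (D-0017)

noncomputable section

open scoped Classical

open WeierstrassCurve NumberField Literature.NumberTheory.EllipticCurves
  Literature.NumberTheory.EllipticCurves.ModularForms
  Literature.NumberTheory.EllipticCurves.Rank1Residual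
  Literature.NumberTheory.GaloisRepresentations
  Summit.BirchSwinnertonDyer.Rank1Residual
  Summit.BirchSwinnertonDyer.Rank1Residual.AdditivePotMult
  Summit.BirchSwinnertonDyer.BirchSwinnertonDyer.Rank1Residual
  Summit.BirchSwinnertonDyer.BirchSwinnertonDyer.Theorems.CMExactDescent
  Summit.BirchSwinnertonDyer.BirchSwinnertonDyer.Theorems.GenusExact.TwinSwap

namespace Summit.BirchSwinnertonDyer.BirchSwinnertonDyer.Theorems.GenusExact.TwinSwap.IdentityDoor

/-! ## §4 The identity-locus cell engine: wall + converse + identity-door supply + Kolyvagin-exactness-shaped exponent -/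

section Cells

open Summit.BirchSwinnertonDyer.Rank1Residual.F1Sign2 (MeetsEgg NoRationalTwoTorsion ShaTwoTrivial selmerGroupRelaxedAtInfinityAtTwo)
open Summit.BirchSwinnertonDyer.BirchSwinnertonDyer.Theorems.GenusExact.TwinSwap.Egg (shaTwoTrivial_of_natCard_selmerGroup_eq_two)
open Summit.BirchSwinnertonDyer.BirchSwinnertonDyer.Theorems.GenusExact.TwinSwap.Ledger.Line25
  (entireLFunction_twist_one_ne_zero_of_rankZeroTwoConverse_of_natCard_selmerGroup_eq_one
    exists_kolyvaginHeegnerData_one_of_nonempty_modularParametrizationData not_isOfFinAddOrder_derivedPoint_one_of_rankOne_of_lValue_ne_zero)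

/-- **U₂ ON THE `Δ > 0` IDENTITY LOCUS WITH `ρ̄_{W,2}` ONTO, EVERY TAMAGAWA DEPTH, EVERY 2-ADIC IMAGE — from the wall, the rank-zero 2-converse,
the IDENTITY-DOOR SUPPLY and the Kolyvagin-exactness-shaped exponent.**  Hypotheses: the PRINT facts (`hGZ`, `hGZK`, `hmod`, `hMilneC`, `hMP`); S1
(`hS1`: BSD₂ for non-CM rank-0 curves with `#Sel₂ = 1`); CONV₀ (`hC0`: the rank-zero `2`-converse on all non-CM globally minimal curves); the
IDENTITY-DOOR SUPPLY `hIDS` — for `W` non-CM, `r_an = 1`, `#Sel₂ = 2`, `ρ̄_{W,2}` onto, `Δ > 0`, `¬ MeetsEgg`: some imaginary quadratic `K = ℚ(√−ℓ)`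
(`ℓ` prime, `d_K = −ℓ` odd `≠ −3`, Heegner for `N_W`, `2` split) with `ℓ` an IDENTITY prime (`#W(ℚ_ℓ)[2] = 4`) at which `Sel₂^{rel ∞}(W)` localises
injectively, and a globally minimal model `Wd` of `W^{(d_K)}` (a ČEBOTAREV statement, print-reachable: Mazur–Rubin twisting primes for TWO classes);
and `hKEX` = KEX_id: at every such field with `L(W^{(d_K)},1) ≠ 0` and every conductor-`1` datum, SOME exact depth `2^{M₀} ∥ P(1)` with
`#Ш(W_K)[2^∞] · 4^{ord₂ c + ord₂ C(W)} = 4^{M₀}` (the BSD₂ content there, lossless: `natCard_sha_mul_eq_of_bsdp`).  CONCLUSION: `BSD₂(W)` for every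
non-CM globally minimal `W` with `r_an = 1`, `#Sel₂ = 2`, `ρ̄_{W,2}` onto, `Δ > 0`, `W(ℚ) ⊂ W⁰(ℝ)`.  Proof: GZK gives rank `1`, so every Selmer class is
trivial at `∞` (`GenusKolyArch.forall_mem_selmerGroup_localization_inl_eq_zero_of_not_meetsEgg`); the supplied identity door has `#Sel₂(Wd) = 1`
(`natCard_selmerGroup_twin_eq_one_of_identityDoor`, UNCONDITIONAL); `hC0` gives `L(W^{(d_K)},1) ≠ 0`, hence `P(1)` of infinite order, `r_an(Wd) = 0` and
`BSD₂(Wd)` from S1; then `swappedPairDescentAtTwo_shaDepth_of_facts` with the exponent from `hKEX`.  CONDITIONAL on the displayed hypotheses; proves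
nothing about BSD; closes nothing.  [cite: MazurRubin2010, Lemmas 2.9–2.11, Prop. 3.3] [cite: Kramer1981, Thm. 1] [cite: GrossZagier1986, V.§2 (2.2)]
[cite: Milne1972ArithmeticAV, §1 Thm. 1] [cite: Miller2011LMS, Def. 1.1] -/
theorem bsdp_posDisc_idLocus_of_wall_of_converse_of_idSupply_of_kex_of_facts
    (hGZ : ∀ (N : ℕ) [NeZero N] (W : WeierstrassCurve ℚ) (K : Type) [Field K] [NumberField K], gross_zagier N W K)
    (hGZK : rank_eq_analyticRank_of_analyticRank_le_one) (hmod : hasEntireLFunction_rat)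
    (hMilneC : Milne1972.bsdQuotient_baseChange_quadratic_anyModel) (hMP : nonempty_modularParametrizationData)
    (hS1 : ∀ (W : WeierstrassCurve ℚ) [W.IsElliptic] [W.IsGloballyMinimal],
      ¬ W.HasCM → W.analyticRank = 0 → Nat.card (W.selmerGroup 2) = 1 → BSDp W 2)
    (hC0 : ∀ (V : WeierstrassCurve ℚ) [V.IsElliptic] [V.IsGloballyMinimal], ¬ V.HasCM → V.selmerCorank 2 = 0 → V.analyticRank = 0)
    (hIDS : ∀ (W : WeierstrassCurve ℚ) [W.IsElliptic] [W.IsGloballyMinimal] [NeZero (W.conductorNorm ℤ)],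
      ¬ W.HasCM → W.analyticRank = 1 → Nat.card (W.selmerGroup 2) = 2 → W.HasSurjectiveModNGaloisRep 2 → 0 < W.Δ → ¬ MeetsEgg W →
      ∃ (K : Type) (_ : Field K) (_ : NumberField K) (ℓ : ℕ) (_ : Fact ℓ.Prime),
        IsImaginaryQuadratic K ∧ NumberField.discr K = -(ℓ : ℤ) ∧
        Nat.card {Q : (W.baseChange ℚ_[ℓ]).toAffine.Point // 2 • Q = 0} = 4 ∧
        (∀ c ∈ selmerGroupRelaxedAtInfinityAtTwo W, c ∈ MazurRubin2010.strictLocalKer W ℚ_[ℓ] 2 → c = 0) ∧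
        Odd (NumberField.discr K) ∧ NumberField.discr K ≠ -3 ∧ SatisfiesHeegnerHypothesis (W.conductorNorm ℤ) K ∧
        ((Ideal.span {(2 : ℤ)}).primesOver (𝓞 K)).ncard = 2 ∧
        ∃ (Wd : WeierstrassCurve ℚ) (_ : Wd.IsElliptic) (_ : Wd.IsGloballyMinimal),
          ∃ C : VariableChange ℚ, C • W.quadraticTwist (NumberField.discr K : ℚ) = Wd)
    (hKEX : ∀ (W : WeierstrassCurve ℚ) [W.IsElliptic] [W.IsGloballyMinimal] [NeZero (W.conductorNorm ℤ)],
      ¬ W.HasCM → W.analyticRank = 1 → Nat.card (W.selmerGroup 2) = 2 → W.HasSurjectiveModNGaloisRep 2 → 0 < W.Δ → ¬ MeetsEgg W →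
      ∀ (K : Type) [Field K] [NumberField K], IsImaginaryQuadratic K →
        ∀ (ℓ : ℕ) [Fact ℓ.Prime], NumberField.discr K = -(ℓ : ℤ) →
        Nat.card {Q : (W.baseChange ℚ_[ℓ]).toAffine.Point // 2 • Q = 0} = 4 →
        (∀ c ∈ selmerGroupRelaxedAtInfinityAtTwo W, c ∈ MazurRubin2010.strictLocalKer W ℚ_[ℓ] 2 → c = 0) →
        Odd (NumberField.discr K) → NumberField.discr K ≠ -3 → SatisfiesHeegnerHypothesis (W.conductorNorm ℤ) K →
        ((Ideal.span {(2 : ℤ)}).primesOver (𝓞 K)).ncard = 2 →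
        (W.quadraticTwist (NumberField.discr K : ℚ)).entireLFunction 1 ≠ 0 →
        ∀ (Dt : ModularParametrizationData W (W.conductorNorm ℤ)) (β : ℤ) (ι : K →+* ℂ) (d₁ : KolyvaginHeegnerData Dt β ι 1),
          ∃ M₀ : ℕ,
            (∃ Q : (W.baseChange (ringClassField K ι 1)).toAffine.Point, ((2 ^ M₀ : ℕ) : ℤ) • Q = d₁.derivedPoint) ∧
            (¬ ∃ Q : (W.baseChange (ringClassField K ι 1)).toAffine.Point, ((2 ^ (M₀ + 1) : ℕ) : ℤ) • Q = d₁.derivedPoint) ∧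
            Nat.card (AddCommGroup.primaryComponent (W.baseChange K).sha 2) *
                2 ^ (2 * (padicValInt 2 Dt.c + padicValNat 2 W.tamagawaProduct)) = 2 ^ (2 * M₀)) :
    ∀ (W : WeierstrassCurve ℚ) [W.IsElliptic] [W.IsGloballyMinimal], ¬ W.HasCM → W.analyticRank = 1 →
      Nat.card (W.selmerGroup 2) = 2 → W.HasSurjectiveModNGaloisRep 2 → 0 < W.Δ → ¬ MeetsEgg W → BSDp W 2 := by
  intro W _ _ hcm hr hSel hsurj hΔ hegg
  haveI : NeZero (W.conductorNorm ℤ) := ⟨(W.conductorNorm_pos_holds).ne'⟩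
  -- rank one (GZK): every Selmer class of `W` is trivial at `∞`
  have hrk : W.mordellWeilRank = 1 := by rw [(hGZK W (le_of_eq hr)).1, hr]
  have hT : NoRationalTwoTorsion W := GenusKolyTwin.noRationalTwoTorsion_of_hasSurjectiveModNGaloisRep W (by simpa using hsurj)
  have hSha : ShaTwoTrivial W := shaTwoTrivial_of_natCard_selmerGroup_eq_two W hSel (le_of_eq hrk.symm)
  have hstr := GenusKolyArch.forall_mem_selmerGroup_localization_inl_eq_zero_of_not_meetsEgg W hΔ hT hSha hegg
  -- the identity door (supply) and its `2`-Selmer-trivial twin (UNCONDITIONAL count)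
  obtain ⟨K, _, _, ℓ, hℓF, hK, hd, hid, hinj, hodd, h3, hH, h2K, Wd, _, _, Cd, hCd⟩ := hIDS W hcm hr hSel hsurj hΔ hegg
  have hSel1 : Nat.card (Wd.selmerGroup 2) = 1 :=
    natCard_selmerGroup_twin_eq_one_of_identityDoor W hΔ hSel hK hodd hH h2K hd hid hstr hinj Wd ⟨Cd, hCd⟩
  have hD0 : (NumberField.discr K : ℚ) ≠ 0 := by exact_mod_cast NumberField.discr_ne_zero K
  haveI := W.isElliptic_quadraticTwist hD0
  -- the central value through the rank-zero 2-converse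
  have hL : (W.quadraticTwist (NumberField.discr K : ℚ)).entireLFunction 1 ≠ 0 :=
    entireLFunction_twist_one_ne_zero_of_rankZeroTwoConverse_of_natCard_selmerGroup_eq_one hC0 hmod W hcm hD0 Wd hCd hSel1
  -- a conductor-1 datum, its Heegner point of infinite order, and the exactness-shaped exponent
  obtain ⟨Dt, β, ι, d₁, hc0⟩ := exists_kolyvaginHeegnerData_one_of_nonempty_modularParametrizationData hMP W K hK hH
  have hy : ¬ IsOfFinAddOrder d₁.derivedPoint :=
    not_isOfFinAddOrder_derivedPoint_one_of_rankOne_of_lValue_ne_zero hmod W K (hGZ _ W K) hK hH hr hL d₁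
  obtain ⟨M₀, hdiv, hndiv, hsha⟩ := hKEX W hcm hr hSel hsurj hΔ hegg K hK ℓ hd hid hinj hodd h3 hH h2K hL Dt β ι d₁
  -- the twin is non-CM of analytic rank 0: `BSD₂(Wd)` from the wall
  have hcmd : ¬ Wd.HasCM := by
    rw [← hCd, hasCM_iff_of_j_eq (((W.quadraticTwist (NumberField.discr K : ℚ)).variableChange_j Cd).trans (W.j_quadraticTwist hD0))]
    exact hcm
  have hrd : Wd.analyticRank = 0 := by
    rw [← hCd, analyticRank_smul]
    exact ((W.quadraticTwist (NumberField.discr K : ℚ)).analyticRank_eq_zero_iff_holds (hmod _)).mpr hL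
  have hBd : BSDp Wd 2 := hS1 Wd hcmd hrd hSel1
  exact swappedPairDescentAtTwo_shaDepth_of_facts hGZ hGZK hmod hMilneC W hr hSel K hK hodd h3 hH Dt hc0 β ι d₁ hy M₀ hdiv hndiv hsha
    Wd ⟨Cd, hCd⟩ hSel1 hBd

end Cells

end Summit.BirchSwinnertonDyer.BirchSwinnertonDyer.Theorems.GenusExact.TwinSwap.IdentityDoor

end
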